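import Literature.NumberTheory.EllipticCurves.Milne1972.WeilRestrictionQuadraticBSDQuotientOfAnyModelProofs
import Literature.NumberTheory.EllipticCurves.BSDSelmerParityDokchitserProp417Proofs
import Literature.NumberTheory.EllipticCurves.BSDRootNumberSmallConductorProofs
import Literature.NumberTheory.EllipticCurves.ComplexPeriodProofs
import Literature.NumberTheory.EllipticCurves.RegulatorProofs
import Literature.NumberTheory.EllipticCurves.MordellWeilProofs
import HarnessLib

/-!
# The Birch–Swinnerton-Dyer quotient, the analytic order of `Ш` and `BSD(E/F, p)` for an elliptic
# curve over a number field

Topic `NumberTheory/EllipticCurves`. Definition request `defn-BSDQuotientOverNumberField` (route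
`TameQuarticSolvent` of `BirchSwinnertonDyer`, D1: "a BSD-quotient / `Ш_an` currency for elliptic
curves over number fields", needed to state exact `BSD₃(E/L″)` over a totally real quartic field and
its descent to `ℚ`). The tree has every INGREDIENT of the Birch–Swinnerton-Dyer formula for a
Weierstrass model `V` of an elliptic curve over a number field `F` — `V.leadingLCoeff`
(`L^{(r)}(E/F,1)/r!`, `AnalyticRank.lean`), `V.mordellWeilRank`, `V.torsionOrder` (`MordellWeil.lean`),
`V.regulator` (Néron–Tate regulator relative to `F`, `Regulator.lean`), `V.bsdPeriod`
(`∏_{w∣∞} ∫|ω_V|_w / |d_F|^{1/2}`, `ComplexPeriod.lean`), `V.modifiedTamagawaProduct`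
(Dokchitser–Dokchitser's `C(E/F) = ∏_{w∤∞} c_w |ω_V/ω_w°|_w`, `ModifiedTamagawaProduct.lean`),
`V.sha`, `V.shaOrder` (`Sha.lean`) — and the formula itself over `ℚ` (`WeierstrassCurve.bsdRHS`,
Miller's `shaAn W` and `BSDp W p`, `BSDRootNumberSmallConductorProofs.lean`), but so far no NAME for
the three printed notions over a general number field. This file supplies them, verbatim from

* T. Dokchitser, V. Dokchitser, *On the Birch–Swinnerton-Dyer quotients modulo squares*, Ann. of
  Math. 172 (2010) 567–596 (= arXiv:math/0610290), §2.1, Conjecture 2.1 (Birch–Swinnerton-Dyer,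
  Tate [Sém. Bourbaki 306]) and the Notation following it (arXiv p. 5):
  > "`BSD(A/K) = |Ш(A/K)| Reg(A/K) C(A/K) / (|A(K)_tors| |A^t(K)_tors| |Δ_K|^{dim A/2}) ·
  > ∏_{v∣∞ real} ∫_{A(K_v)} |ω| · ∏_{v∣∞ cplx} 2∫_{A(K_v)} ω ∧ ω̄`. […] We call `BSD(A/K)` the
  > Birch–Swinnerton-Dyer quotient for `A/K`. We also write `BSD_p(A/K)` for the same expression
  > with `Ш` replaced by its `p`-primary component `Ш[p^∞]`. (They are independent of the choice
  > of `ω` by the product formula.)"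
  with (§1 Notation, arXiv pp. 4–5) "`C(E/K) = ∏_{v∤∞} c_v |ω/ω_v°|_v`", and Conjecture 2.1 itself:
  "`ord_{s=1} L(A/K,s) = rk A(K)`; `Ш(A/K)` is finite, and the leading coefficient of `L(A/K,s)` at
  `s = 1` is `BSD(A/K)`";
* R. L. Miller, LMS J. Comput. Math. 14 (2011), §1 and Def. 1.1 (arXiv:1010.2431 p. 3): "`#Ш(ℚ,E)_an`,
  the value of `#Ш(ℚ,E)` for which the conjectural formula holds" and "`BSD(E/ℚ,p)`: […] the
  `p`-primary part `Ш(ℚ,E)(p)` is finite; `#Ш(ℚ,E)_an` is rational; the conjectural formula holds at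
  `p`, i.e. `ord_p(#Ш(ℚ,E)_an) = ord_p(#Ш(ℚ,E)(p))`" — the tree's `shaAn` / `BSDp` over `ℚ`.

## Contents

* `bsdQuotient V : ℝ` — Dokchitser–Dokchitser's **Birch–Swinnerton-Dyer quotient** `BSD(E/F)` of an
  elliptic curve (`dim A = 1`, `A^t = A`) on the model `V` with differential `ω = ω_V`:
  `#Ш(E/F) · Reg(E/F) · Ω(E/F, ω_V) · C(E/F, ω_V) / #E(F)_tors²`, `Ω(E/F, ω_V) = V.bsdPeriod`
  (archimedean integrals over `|d_F|^{1/2}`), `C(E/F, ω_V) = V.modifiedTamagawaProduct`. It is —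
  syntactically — the left-hand side of the tree's named facts
  `Milne1972.bsdQuotient_baseChange_quadratic_anyModel` and, for `F = ℚ` and `V` globally minimal,
  the tree's `V.bsdRHS` (`bsdQuotient_eq_bsdRHS`).
* `analyticSha V : ℂ` — the **analytic order of `Ш`**, `#Ш(E/F)_an := L^{(r)}(E/F,1)/r! · #E(F)_tors² /
  (Ω(E/F, ω_V) · C(E/F, ω_V) · Reg(E/F))`, i.e. Conjecture 2.1's leading-term formula solved for
  `#Ш` (Miller's `#Ш_an`, transported verbatim from `ℚ` to `F`): `analyticSha_mul_bsdQuotient`,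
  `leadingLCoeff_eq_bsdQuotient_iff`; for `F = ℚ` and `V` globally minimal it is the tree's `shaAn V`
  (`analyticSha_eq_shaAn`).
* `BSDpOver V p : Prop` — **the `p`-part of the Birch–Swinnerton-Dyer formula for `E` over `F`**,
  Miller's `BSD(E,p)` clauses (ii)–(iv) over `F` ("the same expression with `Ш` replaced by
  `Ш[p^∞]`", Dokchitser–Dokchitser): `Ш(E/F)[p^∞]` is finite, `#Ш(E/F)_an` is a rational `q`, and
  `ord_p q = ord_p #Ш(E/F)[p^∞]`. For finite `Ш(E/F)` the last clause reads `ord_p q = ord_p #Ш(E/F)`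
  (`bsdpOver_iff_of_shaFinite`); for `F = ℚ` and `V` globally minimal, Miller's `BSDp V p` is exactly
  `rank = r_an ∧ BSDpOver V p` (`bsdp_iff_rank_and_bsdpOver`).
* positivity `bsdQuotient_pos` (finite `Ш`), and the unfolding lemmas.

## Design choices

* ANY model `V`, with Dokchitser–Dokchitser's `C(E/F, ω_V)` compensating the period of `ω_V`
  (product formula): a globally minimal `F`-model need not exist (Weierstrass class in `Cl(F)`), and
  the cited statement is printed for an arbitrary differential. The quantities do not depend on the
  model (loc. cit., "independent of the choice of `ω` by the product formula"); this is NOT proved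
  here (no consumer; it needs the transformation of `localTamagawaFactor` under `VariableChange`).
* `analyticSha V : ℂ` and "`#Ш_an` is rational" as `∃ q : ℚ, analyticSha V = q`, exactly as the
  tree's `shaAn` / `BSDp` over `ℚ` (`V.leadingLCoeff` is complex).
* `BSDpOver` does NOT contain Miller's clause (i) `rank E(F) = r_an(E/F)` (the tree's separate
  statement `V.mordellWeilRank = V.analyticRank`), so that it is literally "the formula at `p`"; over
  `ℚ` the conjunction with (i) is Miller's `BSDp` (`bsdp_iff_rank_and_bsdpOver`). It DOES contain the
  finiteness of `Ш[p^∞]` (Miller (ii); Dokchitser–Dokchitser, proof of Thm. 2.3: "provided that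
  `Ш(A/F)[p^∞]` is finite"), without which `Nat.card Ш[p^∞] = 0` would be a junk value.
* Names. `analyticSha` / `BSDpOver` / `bsdQuotient` rather than `shaAnOver`: the cell files
  `Summits/BirchSwinnertonDyer/Rank1Residual/AdditivePotMult/{Descent,ModelFree}.lean` already declare
  `Summit.….AdditivePotMult.shaAnOver` (plain Tamagawa product, globally minimal models) and
  `….shaAnOverC` (this normalisation) and a dozen Summits files use them unqualified next to
  `open Literature.NumberTheory.EllipticCurves`; a homonym here would make those ambiguous.
  `analyticSha V` is definitionally `AdditivePotMult.shaAnOverC V`, and `AdditivePotMult.MissingPPartOverCAt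
  V p` is the right-hand side of `bsdpOver_iff_of_shaFinite` (both `rfl`, checked, not importable here).
* Junk values are those of the ingredients (`leadingLCoeff`/`analyticRank` if `L(E/F,s)` has no
  entire continuation — conjectural for general `F`, a theorem for totally real `F` and modular `E`;
  `regulator`, `shaOrder`, `torsionOrder` as documented in their files).

NOT here: the conjecture over `F` as a closed statement (it is `V.mordellWeilRank = V.analyticRank ∧
V.ShaFinite ∧ V.leadingLCoeff = bsdQuotient V` for elliptic `V`; the tree states BSD over `ℚ` only,
`Summits/BirchSwinnertonDyer`), Dokchitser–Dokchitser's quantity `BSD_p(A/K)` itself, abelian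
varieties of dimension `> 1`, model-independence. No named fact is introduced (D-0026): three
definitions and proved lemmas only.
-/

noncomputable section

open scoped Classical

namespace Literature.NumberTheory.EllipticCurves

open _root_.WeierstrassCurve

/-! ### The three notions -/

section Definitions

variable {F : Type*} [Field F] [NumberField F] (V : WeierstrassCurve F)

/-- The **Birch–Swinnerton-Dyer quotient `BSD(E/F)`** of Dokchitser–Dokchitser (Ann. of Math. 172
(2010), §2.1, Conj. 2.1 and Notation, after Tate, Sém. Bourbaki 306) for an elliptic curve over the
number field `F`, computed on the Weierstrass model `V` with its differential `ω_V`: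
*"`BSD(A/K) = |Ш(A/K)| Reg(A/K) C(A/K) / (|A(K)_tors||A^t(K)_tors||Δ_K|^{dim A/2}) ·
∏_{v real} ∫_{A(K_v)}|ω| · ∏_{v cplx} 2∫_{A(K_v)} ω∧ω̄`. […] We call `BSD(A/K)` the Birch–Swinnerton-Dyer
quotient for `A/K`"*, here with `dim A = 1`, `A^t = A`:
`#Ш(E/F) · Reg(E/F) · Ω(E/F, ω_V) · C(E/F, ω_V) / #E(F)_tors²`, where
`Ω(E/F, ω_V) = V.bsdPeriod = ∏_{w∣∞} placePeriod V w / |d_F|^{1/2}` (`ComplexPeriod.lean`) and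
`C(E/F, ω_V) = V.modifiedTamagawaProduct = ∏_{w∤∞} c_w |ω_V/ω_w°|_w` (`ModifiedTamagawaProduct.lean`, §1
Notation of loc. cit.). Conjecture 2.1 (2) reads `V.ShaFinite ∧ V.leadingLCoeff = bsdQuotient V`.
Independent of the model (product formula; not proved here). Junk value `#Ш = 0` when `Ш(E/F)` is
infinite (`shaOrder`), so it is meaningful jointly with `V.ShaFinite`. Syntactically the left-hand
side of `Milne1972.bsdQuotient_baseChange_quadratic_anyModel`; equal to `V.bsdRHS` for a globally
minimal model over `ℚ` (`bsdQuotient_eq_bsdRHS`).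
[cite: DokchitserDokchitserAnnals2010, §2.1 Conj. 2.1 and Notation (arXiv p. 5); §1 Notation (arXiv pp. 4–5)]
[cite: Tate1966Bourbaki] -/
def bsdQuotient : ℝ :=
  (V.shaOrder : ℝ) * V.regulator * V.bsdPeriod * (V.modifiedTamagawaProduct : ℝ) /
    (V.torsionOrder : ℝ) ^ 2

/-- Unfolding of `bsdQuotient` (by definition).
[cite: DokchitserDokchitserAnnals2010, §2.1 Conj. 2.1 and Notation (arXiv p. 5)] -/
theorem bsdQuotient_def :
    bsdQuotient V = (V.shaOrder : ℝ) * V.regulator * V.bsdPeriod *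
      (V.modifiedTamagawaProduct : ℝ) / (V.torsionOrder : ℝ) ^ 2 := rfl

/-- The **analytic order of `Ш` over a number field**, `#Ш(E/F)_an :=
(L^{(r)}(E/F,1)/r!) · #E(F)_tors² / (Ω(E/F, ω_V) · C(E/F, ω_V) · Reg(E/F))` with
`r = r_an = ord_{s=1} L(E/F,s)` (`V.analyticRank`, inside `V.leadingLCoeff`): the leading-term formula
of Conjecture 2.1 of Dokchitser–Dokchitser (Birch–Swinnerton-Dyer, Tate) — *"the leading coefficient
of `L(A/K,s)` at `s = 1` is `BSD(A/K)`"* — solved for `|Ш(A/K)|`, i.e. Miller's *"`#Ш_an`, the value of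
`#Ш` for which the conjectural formula holds"* (LMS J. Comput. Math. 14 (2011) §1, over `ℚ`; the tree's
`shaAn`) transported word for word to `F`, on the model `V` with differential `ω_V`
(`Ω = V.bsdPeriod`, `C = V.modifiedTamagawaProduct`, `Reg = V.regulator`, `#E(F)_tors = V.torsionOrder`).
A complex number (the tree's leading coefficient is one); `analyticSha V · bsdQuotient V =
L^{(r)}(E/F,1)/r! · #Ш(E/F)` (`analyticSha_mul_bsdQuotient`), so the leading-term formula says
`analyticSha V = #Ш(E/F)` (`leadingLCoeff_eq_bsdQuotient_iff`). For `F = ℚ` and `V` globally minimal it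
is `shaAn V` (`analyticSha_eq_shaAn`). Definitionally the cell's
`Summit.BirchSwinnertonDyer.Rank1Residual.AdditivePotMult.shaAnOverC V`.
[cite: DokchitserDokchitserAnnals2010, §2.1 Conj. 2.1 and Notation (arXiv p. 5)]
[cite: Miller2011LMS, §1 (arXiv:1010.2431 p. 3)] -/
def analyticSha : ℂ :=
  V.leadingLCoeff * (V.torsionOrder : ℂ) ^ 2 /
    ((V.bsdPeriod : ℂ) * (V.modifiedTamagawaProduct : ℂ) * (V.regulator : ℂ))

/-- Unfolding of `analyticSha` (by definition). [cite: Miller2011LMS, §1 (arXiv:1010.2431 p. 3)] -/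
theorem analyticSha_def :
    analyticSha V = V.leadingLCoeff * (V.torsionOrder : ℂ) ^ 2 /
      ((V.bsdPeriod : ℂ) * (V.modifiedTamagawaProduct : ℂ) * (V.regulator : ℂ)) := rfl

/-- **`BSD(E/F, p)`, the `p`-part of the Birch–Swinnerton-Dyer formula** for the elliptic curve with
model `V` over the number field `F` and a (prime) number `p`: Miller's `BSD(E,p)` (LMS J. Comput.
Math. 14 (2011), Def. 1.1: *"the `p`-primary part `Ш(ℚ,E)(p)` of the Shafarevich–Tate group is
finite; the real number `#Ш(ℚ,E)_an` is rational; the [Birch–Swinnerton-Dyer] formula holds at `p`,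
i.e. `ord_p(#Ш(ℚ,E)_an) = ord_p(#Ш(ℚ,E)(p))`"*) with `ℚ` replaced by `F` — equivalently the `p`-adic
valuation of the leading-term statement 2.1 (2) of Dokchitser–Dokchitser written with *"`BSD_p(A/K)`,
the same expression with `Ш` replaced by its `p`-primary component `Ш[p^∞]`"* (§2.1 Notation; proof
of Thm. 2.3: *"provided that `Ш(A/F)[p^∞]` is finite"*): (ii) `Ш(E/F)[p^∞] = AddCommGroup.primaryComponent Ш p`
is finite; (iii)–(iv) `#Ш(E/F)_an = analyticSha V` is a rational number `q` with
`padicValRat p q = padicValNat p #Ш(E/F)[p^∞]` (one witness `q`, unique). Miller's clause (i)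
`rank E(F) = r_an(E/F)` is NOT included (it is `V.mordellWeilRank = V.analyticRank`); over `ℚ`, for a
globally minimal model, `BSDp V p ↔ V.mordellWeilRank = V.analyticRank ∧ BSDpOver V p`
(`bsdp_iff_rank_and_bsdpOver`). For finite `Ш(E/F)` clause (iv) is `ord_p q = ord_p #Ш(E/F)`
(`bsdpOver_iff_of_shaFinite`). A predicate; nothing is asserted.
[cite: Miller2011LMS, Def. 1.1 (arXiv:1010.2431 p. 3)]
[cite: DokchitserDokchitserAnnals2010, §2.1 Notation (arXiv p. 5) and proof of Thm. 2.3] -/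
def BSDpOver (p : ℕ) : Prop :=
  Finite (AddCommGroup.primaryComponent V.sha p) ∧
    ∃ q : ℚ, analyticSha V = (q : ℂ) ∧
      padicValRat p q = padicValNat p (Nat.card (AddCommGroup.primaryComponent V.sha p))

/-- Unfolding of `BSDpOver` (by definition). [cite: Miller2011LMS, Def. 1.1 (arXiv:1010.2431 p. 3)] -/
theorem bsdpOver_iff (p : ℕ) :
    BSDpOver V p ↔ Finite (AddCommGroup.primaryComponent V.sha p) ∧
      ∃ q : ℚ, analyticSha V = (q : ℂ) ∧
        padicValRat p q = padicValNat p (Nat.card (AddCommGroup.primaryComponent V.sha p)) :=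
  Iff.rfl

end Definitions

/-! ### Positivity, the leading-term formula as `#Ш_an = #Ш`, and finite `Ш` -/

section API

variable {F : Type*} [Field F] [NumberField F] (V : WeierstrassCurve F)

/-- The Birch–Swinnerton-Dyer quotient of an elliptic curve with finite `Ш` is positive: `#Ш ≥ 1`
(`shaOrder_pos`), `Reg > 0` (`regulator_pos'`, Silverman *AEC* VIII.9.7), `Ω(ω_V) > 0`
(`bsdPeriod_pos'`), `C(ω_V) > 0` (`modifiedTamagawaProduct_pos`), `#E(F)_tors ≥ 1`
(`torsionOrder_pos_holds`) — every factor of Dokchitser–Dokchitser's `BSD(A/K)` (§2.1 Notation) is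
positive. [cite: DokchitserDokchitserAnnals2010, §2.1 Notation (arXiv p. 5)]
[cite: SilvermanAEC2009, Cor. VIII.9.7] -/
theorem bsdQuotient_pos [V.IsElliptic] (hV : V.ShaFinite) : 0 < bsdQuotient V := by
  have hs : (0 : ℝ) < V.shaOrder := Nat.cast_pos.mpr (V.shaOrder_pos hV)
  have hR : (0 : ℝ) < V.regulator := V.regulator_pos'
  have hΩ : (0 : ℝ) < V.bsdPeriod := V.bsdPeriod_pos'
  have hc : (0 : ℝ) < V.modifiedTamagawaProduct := by exact_mod_cast V.modifiedTamagawaProduct_pos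
  have ht : (0 : ℝ) < V.torsionOrder := Nat.cast_pos.mpr V.torsionOrder_pos_holds
  rw [bsdQuotient_def]
  positivity

/-- **`#Ш_an · BSD(E/F) = L^{(r)}(E/F,1)/r! · #Ш`** on any model of an elliptic curve over a number
field (unfold; `Ω(ω_V)`, `C(ω_V)`, `Reg`, `#tors` are nonzero): `#Ш_an` is "the value of `#Ш` for
which the [leading-term] formula holds" (Miller 2011, §1), the formula being `L^* = BSD(E/F)`
(Dokchitser–Dokchitser, §2.1). [cite: Miller2011LMS, §1 (arXiv:1010.2431 p. 3)]
[cite: DokchitserDokchitserAnnals2010, §2.1 Notation (arXiv p. 5)] -/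
theorem analyticSha_mul_bsdQuotient [V.IsElliptic] :
    analyticSha V * (bsdQuotient V : ℂ) = V.leadingLCoeff * (V.shaOrder : ℂ) := by
  have hΩ : (V.bsdPeriod : ℂ) ≠ 0 := by exact_mod_cast V.bsdPeriod_pos'.ne'
  have hc : (V.modifiedTamagawaProduct : ℂ) ≠ 0 := by
    exact_mod_cast (V.modifiedTamagawaProduct_pos).ne'
  have hR : (V.regulator : ℂ) ≠ 0 := by exact_mod_cast V.regulator_pos'.ne'
  have ht : (V.torsionOrder : ℂ) ≠ 0 := by exact_mod_cast V.torsionOrder_pos_holds.ne'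
  rw [analyticSha_def, bsdQuotient_def]
  push_cast
  field_simp

/-- **The leading-term formula over `F` says `#Ш(E/F)_an = #Ш(E/F)`**: for an elliptic curve,
`L^{(r)}(E/F,1)/r! = BSD(E/F)` (Dokchitser–Dokchitser Conj. 2.1 (2), on the model `V`) iff
`analyticSha V = V.shaOrder` — Miller's *"`#Ш_an`, the value of `#Ш` for which the conjectural formula
holds"*. (`Ω(ω_V)`, `C(ω_V)`, `Reg`, `#tors` nonzero; no finiteness of `Ш` needed for the equivalence.)
[cite: Miller2011LMS, §1 (arXiv:1010.2431 p. 3)]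
[cite: DokchitserDokchitserAnnals2010, §2.1 Conj. 2.1 (arXiv p. 5)] -/
theorem leadingLCoeff_eq_bsdQuotient_iff [V.IsElliptic] :
    V.leadingLCoeff = (bsdQuotient V : ℂ) ↔ analyticSha V = (V.shaOrder : ℂ) := by
  have hΩ : (V.bsdPeriod : ℂ) ≠ 0 := by exact_mod_cast V.bsdPeriod_pos'.ne'
  have hc : (V.modifiedTamagawaProduct : ℂ) ≠ 0 := by
    exact_mod_cast (V.modifiedTamagawaProduct_pos).ne'
  have hR : (V.regulator : ℂ) ≠ 0 := by exact_mod_cast V.regulator_pos'.ne'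
  have ht : (V.torsionOrder : ℂ) ≠ 0 := by exact_mod_cast V.torsionOrder_pos_holds.ne'
  rw [analyticSha_def, bsdQuotient_def]
  push_cast
  rw [eq_div_iff (pow_ne_zero 2 ht), div_eq_iff (mul_ne_zero (mul_ne_zero hΩ hc) hR)]
  constructor <;> intro h <;> linear_combination h

/-- **For finite `Ш(E/F)`, `BSD(E/F,p)` is "`#Ш_an` is a rational `q` with `ord_p q = ord_p #Ш(E/F)`":**
the `p`-primary component of a finite abelian group is finite of order `p ^ {ord_p #Ш}`
(`padicValNat_card_addPrimaryComponent`). This right-hand side is the shape of the cell's typed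
over-`K` input `AdditivePotMult.MissingPPartOverCAt V p` (and of `Typed.MissingPPartAt` over `ℚ`).
Miller 2011, §1: for `r_an ≤ 1` "`BSD(E/ℚ,p)` is equivalent to the last equality".
[cite: Miller2011LMS, §1 and Def. 1.1 (arXiv:1010.2431 p. 3)] -/
theorem bsdpOver_iff_of_shaFinite (p : ℕ) [Fact p.Prime] (hV : V.ShaFinite) :
    BSDpOver V p ↔
      ∃ q : ℚ, analyticSha V = (q : ℂ) ∧ padicValRat p q = padicValNat p V.shaOrder := by
  haveI : Finite V.sha := hV
  have hfin : Finite (AddCommGroup.primaryComponent V.sha p) := inferInstance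
  rw [bsdpOver_iff, shaOrder, padicValNat_card_addPrimaryComponent (A := V.sha) p]
  exact ⟨fun h => h.2, fun h => ⟨hfin, h⟩⟩

/-- `BSD(E/F,p)` gives the finiteness of `Ш(E/F)[p^∞]` (clause (ii)).
[cite: Miller2011LMS, Def. 1.1 (arXiv:1010.2431 p. 3)] -/
theorem BSDpOver.finite_primaryComponent {V : WeierstrassCurve F} {p : ℕ} (h : BSDpOver V p) :
    Finite (AddCommGroup.primaryComponent V.sha p) := h.1

/-- `BSD(E/F,p)` gives the rationality of `#Ш(E/F)_an` (clause (iii)).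
[cite: Miller2011LMS, Def. 1.1 (arXiv:1010.2431 p. 3)] -/
theorem BSDpOver.exists_rat_eq {V : WeierstrassCurve F} {p : ℕ} (h : BSDpOver V p) :
    ∃ q : ℚ, analyticSha V = (q : ℂ) := by
  obtain ⟨-, q, hq, -⟩ := h
  exact ⟨q, hq⟩

end API

/-! ### `F = ℚ`: the tree's `bsdRHS`, `shaAn`, `BSDp` -/

section Rat

variable (W : WeierstrassCurve ℚ) [W.IsElliptic] [W.IsGloballyMinimal]

/-- **Over `ℚ`, on a globally minimal model, the Birch–Swinnerton-Dyer quotient is the tree's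
`bsdRHS`** (`#Ш · Reg · Ω · ∏ c_p / #E(ℚ)_tors²`, `BSDInvariants.lean`): `d_ℚ = 1` and the one
infinite place is real (`bsdPeriod_eq_realPeriod_baseChange`), and `ω_W` is a Néron differential at
every prime so `C(E/ℚ, ω_W) = ∏ c_p` (`modifiedTamagawaProduct_eq_tamagawaProduct_of_isGloballyMinimal`).
[cite: DokchitserDokchitserAnnals2010, §2.1 Conj. 2.1 (arXiv p. 5); §1 Notation (arXiv pp. 4–5)] -/
theorem bsdQuotient_eq_bsdRHS : bsdQuotient W = W.bsdRHS := by
  rw [bsdQuotient_def, bsdRHS_def, bsdPeriod_eq_realPeriod_baseChange,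
    modifiedTamagawaProduct_eq_tamagawaProduct_of_isGloballyMinimal, Rat.cast_natCast]
  rfl

/-- **Over `ℚ`, on a globally minimal model, `analyticSha` is Miller's `#Ш(ℚ,E)_an`** (the tree's
`shaAn`, with `Ω = realPeriodRat` and the plain Tamagawa product).
[cite: Miller2011LMS, §1 (arXiv:1010.2431 p. 3)] -/
theorem analyticSha_eq_shaAn : analyticSha W = shaAn W := by
  rw [analyticSha_def, shaAn_def, bsdPeriod_eq_realPeriod_baseChange,
    modifiedTamagawaProduct_eq_tamagawaProduct_of_isGloballyMinimal, Rat.cast_natCast]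
  rfl

/-- **Over `ℚ`, on a globally minimal model, Miller's `BSD(E,p)` is clause (i) together with
`BSD(E/ℚ,p)` of this file**: `BSDp W p ↔ W.mordellWeilRank = W.analyticRank ∧ BSDpOver W p`.
[cite: Miller2011LMS, Def. 1.1 (arXiv:1010.2431 p. 3)] -/
theorem bsdp_iff_rank_and_bsdpOver (p : ℕ) :
    BSDp W p ↔ W.mordellWeilRank = W.analyticRank ∧ BSDpOver W p := by
  rw [bsdp_iff, bsdpOver_iff, analyticSha_eq_shaAn]

end Rat

end Literature.NumberTheory.EllipticCurves

end
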